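import Summits.AtomisticToContinuum.BoseEinsteinCondensation.Theorems.BECInfDivCoherenceGridInfDivCoherenceCoherencePosIntegrable
import HarnessLib

/-!
# Crux `GridInfDivCoherence` (stmt-AtomisticToContinuum-9114), line `registered`:
# positivity of the translation coherence of maximal-form GROUND STATES — INTEGRABLE pair profiles

Route `BECInfDivCoherence`, sub-problem `BoseEinsteinCondensation`. Registered stub
`stub_groundStateCoherencePos_integrable` (lead c4's ground-state form of the positivity conjunct (P) of the
crux): for every repulsive finite-range `v` with integrable profile `∫_{ℝ³} v(|x|) dx < ∞`, at every density
`0 < ρ < ρ₀ = 1` and every `N ≥ 1`, every unit vector `f` of the ground-state class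
`maxFormGroundStates v N L` of the maximal form on `L²((ℝ/ℤ)^{3N})`, `L = (N/ρ)^{1/3}`, has strictly positive
translation coherence `re⟪τ_s f, f⟫ > 0` at every single-particle torus shift `s = (0, …, u, …, 0)`.

Proof (a strict subset of `CoherencePosL2.re_setIntegral_conj_translate_mul_pos`): `W = ∑ v^per ∈ L¹` of the
cell (`lintegral_cellN_periodicInteraction_ne_top_of_lintegral_ne_top`), so the form embedding `ι` has spectral
data `d : TwoModeData ι` (`nonempty_twoModeData`) and `E₀ < ∞`; the class is the ray of the a.e. positive unit
vector `G₀ = |ι φ₁|` (`exists_eq_smul_of_mem_maxFormGroundStates`, Reed–Simon XIII.44/48), so `f = c • G₀`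
with `‖c‖ = 1`, and `re⟪τ_s f, f⟫ = re⟪τ_s G₀, G₀⟫ ≥ g > 0`, the floor of
`CoherencePosL2.exists_coherence_floor` (valid at EVERY shift `s` of the big torus).

References: Reed–Simon IV, Thms XIII.44, XIII.48 (a) [ReedSimonIV1978].
-/

noncomputable section

namespace Summit.AtomisticToContinuum.BoseEinsteinCondensation.Theorems

open MeasureTheory Filter Literature.MathematicalPhysics.QuantumManyBody Literature.MathematicalPhysics.QuantumManyBody.BoseGas
  Literature.Analysis.FunctionSpaces Literature.Analysis.InnerProduct
open scoped ENNReal NNReal ComplexConjugate InnerProductSpace Topology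

attribute [local instance] formDomain_measureSpace formDomain_isProbabilityMeasure
  formDomain_isProbabilityMeasure_pi comparison_isAddHaarMeasure comparison_isAddRightInvariant

/-- **Registered stub `stub_groundStateCoherencePos_integrable` of line `registered` (crux `GridInfDivCoherence`,
stmt-AtomisticToContinuum-9114): positivity of the translation coherence of maximal-form ground states,
INTEGRABLE pair profiles.** For every repulsive finite-range `v` with `∫_{ℝ³} v(|x|) dx < ∞` there is `ρ₀ > 0`
(`ρ₀ = 1`; any works) such that for `0 < ρ < ρ₀`, eventually in `N` (all `N ≥ 1`), every unit vector `f` of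
`maxFormGroundStates v N (sideLength ρ N)` has `0 < re⟪τ_s f, f⟫` for the single-particle torus shift
`s = Pi.single i u` of any particle `i` by any `u ∈ (ℝ/ℤ)³`. The class is the ray of `G₀ = |ι φ₁|`
(`exists_eq_smul_of_mem_maxFormGroundStates`, `CoherencePosL2.formEmbed_φ₁_mem_maxFormGroundStates`,
`absLp_mem_maxFormGroundStates`), so `f = c • G₀` with `‖c‖ = 1` and `re⟪τ f, f⟫ = re⟪τ G₀, G₀⟫`
(`CoherencePosL2.re_inner_map_smul_self`) is at least the floor `g > 0` of
`CoherencePosL2.exists_coherence_floor`. [cite: ReedSimonIV1978, Thm XIII.48 (a)] -/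
theorem stub_groundStateCoherencePos_integrable :
    ∀ v : ℝ → ℝ≥0∞, IsRepulsiveFiniteRange v → (∫⁻ x : Space, v ‖x‖) ≠ ⊤ →
      ∃ ρ₀ : ℝ, 0 < ρ₀ ∧ ∀ ρ : ℝ, 0 < ρ → ρ < ρ₀ → ∀ᶠ N : ℕ in atTop,
        ∀ f : Lp ℂ 2 (volume : Measure (UnitAddTorus (Fin N × Fin 3))),
          f ∈ maxFormGroundStates v N (sideLength ρ N) → ‖f‖ = 1 →
            ∀ (i : Fin N) (u : UnitAddTorus (Fin 3)),
              0 < (⟪(Lp.compMeasurePreservingₗᵢ ℂ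
                  (fun t : UnitAddTorus (Fin N × Fin 3) => t + fun p : Fin N × Fin 3 =>
                    (Pi.single i u : Fin N → UnitAddTorus (Fin 3)) p.1 p.2)
                  (measurePreserving_add_right volume _) f), f⟫_ℂ).re := by
  intro v hv hint
  refine ⟨1, one_pos, fun ρ hρ _ => ?_⟩
  filter_upwards [eventually_ge_atTop 1] with N hN
  intro f hf hf1 i u
  -- the box, `W ∈ L¹` of the cell, spectral data of the form embedding, `E₀ < ∞`
  have hL : 0 < sideLength ρ N := Real.rpow_pos_of_pos (div_pos (Nat.cast_pos.2 hN) hρ) _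
  have hW := lintegral_cellN_periodicInteraction_ne_top_of_lintegral_ne_top hL hv.1 hint N
  obtain ⟨d⟩ := nonempty_twoModeData hL hv.1 hW hN
  have hEtop : periodicGroundStateEnergy v N (sideLength ρ N) ≠ ⊤ := by
    rw [periodicGroundStateEnergy_eq_ofReal d]; exact ENNReal.ofReal_ne_top
  -- the floor of the reference ground state `G₀ = |ι φ₁|`
  obtain ⟨g, hg, hfloor⟩ := CoherencePosL2.exists_coherence_floor hL hv.1 hW hEtop d
  -- the ground-state class is the ray of `G₀`
  have hmem := CoherencePosL2.formEmbed_φ₁_mem_maxFormGroundStates hL hv.1 hW d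
  have hG1 : ‖absLp (formEmbed hL hv.1 hW d.φ₁)‖ = 1 := by rw [norm_absLp, d.norm_map_φ₁]
  have hG0 : absLp (formEmbed hL hv.1 hW d.φ₁) ≠ 0 := by
    rw [← norm_ne_zero_iff, hG1]; exact one_ne_zero
  obtain ⟨c, hc⟩ := exists_eq_smul_of_mem_maxFormGroundStates hL hv.1 hW hEtop
    (absLp_mem_maxFormGroundStates hmem) (absLp_absLp _) hG0 hf
  have hc1 : ‖c‖ = 1 := by
    have h := congrArg norm hc
    rw [hf1, norm_smul, hG1, mul_one] at h
    exact h.symm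
  -- a unit phase does not change the amplitude; conclude with the floor at the given shift
  rw [hc, CoherencePosL2.re_inner_map_smul_self _ _ hc1]
  exact hg.trans_le (hfloor _)

end Summit.AtomisticToContinuum.BoseEinsteinCondensation.Theorems

end
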